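/-
Copyright (c) 2026 the pub-hodgecm-mathlib formalisation cell (harness21).  Prover seat hodgecm-mathlib-K2E3-p21 (g5), Track B «K2-LIT» ∕ h413
(`stmt-HodgeConjecture-24833`), line `K2_E3_EllipticInputs`, unit U12 §L, road «GL-[M6]-sc» (line lead K2E3-p23 (g5), (M16-2) «per-point `hcanc` with explicit radius»;
T20-GL₃ co-owned with K2E5-p17 (g4)), brick T20-GL₃ (C-shell B), FILE 4: «THE PER-POINT `hcanc` AT AN INTEGRAL REPRESENTATIVE IN NORMAL FORM, SPLIT OR MIXED, MONOTONE IN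
THE RADIUS» — the packaging in ASM's currency (★ `exists_setIntegral_norm_conj_le_of_integral_normalForm`, K2E3-p23 (g5)).  2026-09-04.
-/
import Summits.HodgeConjecture.HodgeConjecture.Theorems.K2E3GL3SupercuspOrbitalSliceCancellationMixed  -- ★ (C-shell B) FILE 3 (this seat); brings ★ FILES 1–2, ★ (C), ★ (C-shell A)
import Summits.HodgeConjecture.HodgeConjecture.Theorems.K2E3GL3ModUniformizerNonEllBallMixed        -- ★ ASM-1b (K2E3-p23 g5): `exists_conj_eq_of_coe`, `discr_charpoly_leviBlock`; brings companion
import HarnessLib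

/-!
# K2_E3 road (h413), T20-GL₃ (C-shell B, file 4): `hcanc` at an INTEGRAL representative `g₁` in normal form (split `y·diag d·y⁻¹` or mixed
# `y·[[e₀,e₁,0],[e₂,e₃,0],[0,0,e₄]]·y⁻¹`), `ϖ^h g₁⁻¹` integral, `|disc χ_{g₁}| = q^{−L₀}`: for EVERY `n` and EVERY `R ≥ 150·(s₀ + h + L₀ + 1)`,
# `∫_{Ω n} θ(x̄ · mk g₁ · x̄⁻¹) dμ' = ∫_{Ω n ∩ Ω R} θ(x̄ · mk g₁ · x̄⁻¹) dμ'`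

Cell `pub/hodgecm-mathlib` (D-0151), Track B, seat K2E3-p21 (g5).  CONSUMER: ASM-2 (K2E3-p23 (g5)): the binder `hcanc` of ★ ASM-core `nonEllEstimates_of_radius` is this file a.e.,
via ★ `ae_isCompact_centralizer_or_normalForm` (K2E3-p03) and the integral-representative rescaling of ★ `K2E3GL3ModUniformizerNonEllBall` §1, with ONE radius formula
`R x := 150·(s₀ + hgt x + L x + 1)` for both branches.  `--supports stmt-HodgeConjecture-24833 --as helper`; THEOREMS ONLY.

* §1 MONOTONE-IN-`R` per-point heads **`setIntegral_conj_eq_setIntegral_inter_split_of_le`** ∕ **`…_mixed_of_le`** (★ FILES 2–3 §3 with `R₀ ≤ R`: ★ (C)'s hypothesis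
  `¬𝔅_R(x)` only weakens as `R` grows, ★ `adBall_mono`).
* §2 **`setIntegral_conj_eq_setIntegral_inter_of_integral_split`** (`𝔅_h(g₁)` ⇒ ★ T18-split `y ↦ y·ϖ^e` with `𝔅_{6h+L₀}`, depth `L₀` since `det g₁` is integral;
  `R_split = 150s₀ + 78h + 38L₀ + 6`) and **`…_of_integral_mixed`** (★ companion ∘ ★ T18-mixed `y ↦ y·t` with `𝔅_{L₀}`, `T, N, c` integral by ★ `v_T_le_one` &c.,
  depths `L = L_d = L₀`; `R_mixed = 45s₀ + 13L₀ + 1` — no `h`).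
* §3 **`setIntegral_conj_eq_setIntegral_inter_of_integral_normalForm`** (the disjunction, `R ≥ 150(s₀+h+L₀+1)`) and
  **`exists_radius_setIntegral_conj_eq_setIntegral_inter_of_integral_normalForm`** (`∃ s₀, ∀ g₁ h L₀ …`).
[HarishChandra1970, Part VII §2 Thm 18 + Cor p. 69, Thm 20 p. 70, §3 pp. 71–73 (`Ω(γ)`)]; [Casselman1995, Thm. 5.3.1].

HONEST LABEL: HC_CM is proved only modulo the 7 printed citations (2 remaining named inputs: hLiu418 = `stmt-HodgeConjecture-24832`, h413 = `stmt-HodgeConjecture-24833`)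
until rung 0 closes; this file is a count-neutral helper and closes no socket.

## References
* [HarishChandra1970] Harish-Chandra (notes by G. van Dijk), *Harmonic Analysis on Reductive p-adic Groups*, LNM 162 (1970), Part VII §2 Thm 18–20 pp. 69–70, §3 pp. 71–73.
* [Casselman1995] W. Casselman, *Introduction to the theory of admissible representations of `p`-adic reductive groups* (1995 notes), Thm. 5.3.1, Prop. 1.4.4.
-/

set_option autoImplicit false
-- the mandated namespace repeats the single-problem summit's segment (`HodgeConjecture.HodgeConjecture`)
set_option linter.dupNamespace false

noncomputable section

open MeasureTheory MeasureTheory.Measure Set Filter Topology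
open scoped MatrixGroups Pointwise WithZero
open Literature.NumberTheory.Automorphic Literature.NumberTheory.GaloisRepresentations Literature.NumberTheory.GaloisRepresentations.IsNonarchimedeanLocalField
open Summit.HodgeConjecture.HodgeConjecture.Cruxes.H413.K2E3GLnAdHeightBalls
open Summit.HodgeConjecture.HodgeConjecture.Cruxes.H413.K2E3GLnCuspFormCancellationInputs (mem_standardLeviGL_of_coe_eq_diagonal)
open Summit.HodgeConjecture.HodgeConjecture.Cruxes.H413.K2E3GL3CuspFormCancellation (cuspForm_cancellation_GL3_split)
open Summit.HodgeConjecture.HodgeConjecture.Cruxes.H413.K2E3GL3CuspFormCancellationBlockScalar (cuspForm_cancellation_GL3_blockScalar)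
open Summit.HodgeConjecture.HodgeConjecture.Cruxes.H413.K2E3GL3TruncatedCharSplitTorusRadius (exists_adBall_mul_zpowDiagGL_of_adBall_conj)
open Summit.HodgeConjecture.HodgeConjecture.Cruxes.H413.K2E3GL3TruncatedCharMixedTorusRadius (forall_sq_sub_add_ne_zero_of_irreducible exists_adBall_mul_centralizer_of_conj_integral_mixed)
open Summit.HodgeConjecture.HodgeConjecture.Cruxes.H413.K2E3GL3MixedTorusNormForm (v_T_le_one v_N_le_one v_c_le_one)
open Summit.HodgeConjecture.HodgeConjecture.Cruxes.H413.K2E3GL3MixedCompanionNormalForm (exists_leviBlock_eq_conj_companion charpoly_block_eq)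
open Summit.HodgeConjecture.HodgeConjecture.Cruxes.H413.K2E3GL3ModUniformizerNonEllBallSplit (adBall_of_integral_of_inv)
open Summit.HodgeConjecture.HodgeConjecture.Cruxes.H413.K2E3GL3ModUniformizerNonEllBallMixed (exists_conj_eq_of_coe discr_charpoly_leviBlock)
open Summit.HodgeConjecture.HodgeConjecture.Cruxes.H413.K2E3GL3SupercuspOrbitalSliceCuspidal
open Summit.HodgeConjecture.HodgeConjecture.Cruxes.H413.K2E3GL3CuspFormCancellationShell
open Summit.HodgeConjecture.HodgeConjecture.Cruxes.H413.K2E3GL3SupercuspOrbitalSliceCancellation (exists_support_height slice_support_subset)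
open Summit.HodgeConjecture.HodgeConjecture.Cruxes.H413.K2E3GL3SupercuspOrbitalSliceCancellationMixed

namespace Summit.HodgeConjecture.HodgeConjecture.Cruxes.H413.K2E3GL3SupercuspOrbitalSliceCancellationNormalForm

variable {F : Type*} [Field F] [Valued F ℤᵐ⁰] [ValuativeRel F] [(Valued.v : Valuation F ℤᵐ⁰).Compatible] [IsNonarchimedeanLocalField F] [CharZero F]
  [MeasurableSpace F] [BorelSpace F] [MeasurableSpace (GL (Fin 3) F)] [BorelSpace (GL (Fin 3) F)]
  {ϖ : F} (hϖ : Valued.v ϖ = WithZero.exp (-1 : ℤ)) (hϖ0 : ϖ ≠ 0)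
  [((Subgroup.zpowers (Units.mk0 ϖ hϖ0)).map (Matrix.GeneralLinearGroup.scalar (Fin 3))).Normal]
  [MeasurableSpace (GL (Fin 3) F ⧸ (Subgroup.zpowers (Units.mk0 ϖ hϖ0)).map (Matrix.GeneralLinearGroup.scalar (Fin 3)))]
  [BorelSpace (GL (Fin 3) F ⧸ (Subgroup.zpowers (Units.mk0 ϖ hϖ0)).map (Matrix.GeneralLinearGroup.scalar (Fin 3)))]
  {V : Type*} [AddCommGroup V] [Module ℂ V] (ρ : Representation ℂ (GL (Fin 3) F ⧸ (Subgroup.zpowers (Units.mk0 ϖ hϖ0)).map (Matrix.GeneralLinearGroup.scalar (Fin 3))) V)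
  (hρ : ρ.IsSmooth) (hsc : ρ.IsSupercuspidal) {B : V →ₗ⋆[ℂ] V →ₗ[ℂ] ℂ}
  (hBinv : ∀ (g : GL (Fin 3) F ⧸ (Subgroup.zpowers (Units.mk0 ϖ hϖ0)).map (Matrix.GeneralLinearGroup.scalar (Fin 3))) (v w : V), B (ρ g v) (ρ g w) = B v w) (u u' : V)
  (Ω : CompactExhaustion (GL (Fin 3) F ⧸ (Subgroup.zpowers (Units.mk0 ϖ hϖ0)).map (Matrix.GeneralLinearGroup.scalar (Fin 3))))
  (hmem : ∀ (m : ℕ) (g : GL (Fin 3) F),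
    (QuotientGroup.mk g : GL (Fin 3) F ⧸ (Subgroup.zpowers (Units.mk0 ϖ hϖ0)).map (Matrix.GeneralLinearGroup.scalar (Fin 3))) ∈ Ω m ↔
      ∀ i j k l, Valued.v (ϖ ^ m * ((g : Matrix (Fin 3) (Fin 3) F) i j * ((g⁻¹ : GL (Fin 3) F) : Matrix (Fin 3) (Fin 3) F) k l)) ≤ 1)
  (hK : ∀ (m : ℕ) (k : GL (Fin 3) F), k ∈ glInt 3 F → ∀ x : GL (Fin 3) F ⧸ (Subgroup.zpowers (Units.mk0 ϖ hϖ0)).map (Matrix.GeneralLinearGroup.scalar (Fin 3)),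
    ((QuotientGroup.mk k : GL (Fin 3) F ⧸ _) * x ∈ Ω m ↔ x ∈ Ω m) ∧ (x * (QuotientGroup.mk k : GL (Fin 3) F ⧸ _) ∈ Ω m ↔ x ∈ Ω m))
  (μ' : Measure (GL (Fin 3) F ⧸ (Subgroup.zpowers (Units.mk0 ϖ hϖ0)).map (Matrix.GeneralLinearGroup.scalar (Fin 3)))) [μ'.IsHaarMeasure]

/-! ## §1  The per-point heads, monotone in the radius -/

include hϖ hρ hsc hBinv hmem hK in
/-- **SPLIT, MONOTONE IN `R`**: ★ FILE 2's `setIntegral_conj_eq_setIntegral_inter_split` for every `R ≥ (6s₀+L) + 6(1 + 2s + 4(6s₀+L)) + s` (★ (C)'s hypothesis `x ∉ 𝔅_R` only weakens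
as `R` grows — ★ `adBall_mono`). [cite: HarishChandra1970, Part VII §2 Thm 20 p. 70, §3 pp. 71–72] -/
theorem setIntegral_conj_eq_setIntegral_inter_split_of_le {s₀ : ℕ}
    (hθ : ∀ g : GL (Fin 3) F ⧸ (Subgroup.zpowers (Units.mk0 ϖ hϖ0)).map (Matrix.GeneralLinearGroup.scalar (Fin 3)), B u' (ρ g u) ≠ 0 → g ∈ Ω s₀)
    {γ : GL (Fin 3) F} {d : Fin 3 → F} (hγ : (γ : Matrix (Fin 3) (Fin 3) F) = Matrix.diagonal d) (hd : Function.Injective d) {L : ℕ}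
    (hD : Valued.v (ϖ ^ L * (d 0 * d 1 * d 2) ^ 2) ≤ Valued.v (((d 0 - d 1) * (d 0 - d 2) * (d 1 - d 2)) ^ 2))
    {s : ℕ} {y : GL (Fin 3) F} (hy : ∀ i j k l, Valued.v (ϖ ^ s * ((y : Matrix (Fin 3) (Fin 3) F) i j * ((y⁻¹ : GL (Fin 3) F) : Matrix (Fin 3) (Fin 3) F) k l)) ≤ 1)
    {R : ℕ} (hR : (6 * s₀ + L) + 6 * (1 + 2 * s + 4 * (6 * s₀ + L)) + s ≤ R) (n : ℕ) :
    ∫ x in Ω n, B u' (ρ (x * QuotientGroup.mk (y * γ * y⁻¹) * x⁻¹) u) ∂μ' =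
      ∫ x in Ω n ∩ Ω R, B u' (ρ (x * QuotientGroup.mk (y * γ * y⁻¹) * x⁻¹) u) ∂μ' := by
  haveI : SecondCountableTopology (GL (Fin 3) F) := K2E3GL3ModCentre.secondCountableTopology_gl3 F
  haveI : LocallyCompactSpace (GL (Fin 3) F) := K2E3GL3ModCentre.locallyCompactSpace_gl3 F
  set μ : Measure (GL (Fin 3) F) := Measure.haar with hμ
  have hθc : Continuous fun g : GL (Fin 3) F ⧸ (Subgroup.zpowers (Units.mk0 ϖ hϖ0)).map (Matrix.GeneralLinearGroup.scalar (Fin 3)) => B u' (ρ g u) :=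
    ((Representation.IsSmooth.isLocallyConstant_apply ρ hρ u).comp fun w : V => B u' w).continuous
  refine setIntegral_conj_eq_setIntegral_inter_of_cuspForm_cancellation hϖ hϖ0 μ μ' Ω hmem hK (fun g => B u' (ρ g u)) hθc γ y (fun x hx => ?_) n
  have hx₀ : ¬ ∀ i j k l, Valued.v (ϖ ^ ((6 * s₀ + L) + 6 * (1 + 2 * s + 4 * (6 * s₀ + L)) + s) * ((x : Matrix (Fin 3) (Fin 3) F) i j *
      ((x⁻¹ : GL (Fin 3) F) : Matrix (Fin 3) (Fin 3) F) k l)) ≤ 1 := fun hx' => hx (adBall_mono (v_le_one_of_v_eq_exp hϖ) hR hx')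
  exact cuspForm_cancellation_GL3_split hϖ μ (le_refl 1) hy
    (fun z : GL (Fin 3) F => B u' (ρ (QuotientGroup.mk (z * γ * z⁻¹) : GL (Fin 3) F ⧸ (Subgroup.zpowers (Units.mk0 ϖ hϖ0)).map (Matrix.GeneralLinearGroup.scalar (Fin 3))) u))
    (continuous_slice _ ρ hρ γ u u') (fun z hz => slice_support_subset hϖ hϖ0 Ω hmem _ hθ hγ hD z hz)
    (fun σ ν₀ hν₀ x' => by haveI := hν₀; exact slice_hcuspB _ ρ hρ hsc hBinv hγ hd u u' σ ν₀ x')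
    (fun σ ν₀ hν₀ x' => by haveI := hν₀; exact slice_hcusp12 _ ρ hρ hsc hBinv hγ hd u u' σ ν₀ x')
    (fun σ ν₀ hν₀ x' => by haveI := hν₀; exact slice_hcusp21 _ ρ hρ hsc hBinv hγ hd u u' σ ν₀ x') hx₀

include hϖ hρ hsc hBinv hmem hK in
/-- **MIXED, MONOTONE IN `R`**: ★ FILE 3's `setIntegral_conj_eq_setIntegral_inter_mixed` for every `R ≥ m_C + (1 + 2s + 4m_C) + s`, `m_C = 9s₀ + L + L_d`.
[cite: HarishChandra1970, Part VII §2 Thm 20 p. 70, §3 pp. 71–73] -/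
theorem setIntegral_conj_eq_setIntegral_inter_mixed_of_le {s₀ : ℕ}
    (hθ : ∀ g : GL (Fin 3) F ⧸ (Subgroup.zpowers (Units.mk0 ϖ hϖ0)).map (Matrix.GeneralLinearGroup.scalar (Fin 3)), B u' (ρ g u) ≠ 0 → g ∈ Ω s₀)
    {γ : GL (Fin 3) F} {T N c : F} (hγ : (γ : Matrix (Fin 3) (Fin 3) F) = !![0, -N, 0; 1, T, 0; 0, 0, c]) (hπ : ∀ r : F, r ^ 2 - T * r + N ≠ 0)
    (hT : Valued.v T ≤ 1) (hN : Valued.v N ≤ 1) (hc : Valued.v c ≤ 1)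
    {L : ℕ} (hD : Valued.v (ϖ ^ L) ≤ Valued.v ((T ^ 2 - 4 * N) * (c ^ 2 - T * c + N) ^ 2))
    {Ld : ℕ} (hdisc : Valued.v (ϖ ^ Ld) ≤ Valued.v (T ^ 2 - 4 * N))
    {s : ℕ} {y : GL (Fin 3) F} (hy : ∀ i j k l, Valued.v (ϖ ^ s * ((y : Matrix (Fin 3) (Fin 3) F) i j * ((y⁻¹ : GL (Fin 3) F) : Matrix (Fin 3) (Fin 3) F) k l)) ≤ 1)
    {R : ℕ} (hR : (9 * s₀ + L + Ld) + (1 + 2 * s + 4 * (9 * s₀ + L + Ld)) + s ≤ R) (n : ℕ) :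
    ∫ x in Ω n, B u' (ρ (x * QuotientGroup.mk (y * γ * y⁻¹) * x⁻¹) u) ∂μ' =
      ∫ x in Ω n ∩ Ω R, B u' (ρ (x * QuotientGroup.mk (y * γ * y⁻¹) * x⁻¹) u) ∂μ' := by
  haveI : SecondCountableTopology (GL (Fin 3) F) := K2E3GL3ModCentre.secondCountableTopology_gl3 F
  haveI : LocallyCompactSpace (GL (Fin 3) F) := K2E3GL3ModCentre.locallyCompactSpace_gl3 F
  set μ : Measure (GL (Fin 3) F) := Measure.haar with hμ
  have hθc : Continuous fun g : GL (Fin 3) F ⧸ (Subgroup.zpowers (Units.mk0 ϖ hϖ0)).map (Matrix.GeneralLinearGroup.scalar (Fin 3)) => B u' (ρ g u) :=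
    ((Representation.IsSmooth.isLocallyConstant_apply ρ hρ u).comp fun w : V => B u' w).continuous
  refine setIntegral_conj_eq_setIntegral_inter_of_cuspForm_cancellation hϖ hϖ0 μ μ' Ω hmem hK (fun g => B u' (ρ g u)) hθc γ y (fun x hx => ?_) n
  have hx₀ : ¬ ∀ i j k l, Valued.v (ϖ ^ ((9 * s₀ + L + Ld) + (1 + 2 * s + 4 * (9 * s₀ + L + Ld)) + s) * ((x : Matrix (Fin 3) (Fin 3) F) i j *
      ((x⁻¹ : GL (Fin 3) F) : Matrix (Fin 3) (Fin 3) F) k l)) ≤ 1 := fun hx' => hx (adBall_mono (v_le_one_of_v_eq_exp hϖ) hR hx')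
  exact cuspForm_cancellation_GL3_blockScalar hϖ μ (le_refl 1) hy
    (fun z : GL (Fin 3) F => B u' (ρ (QuotientGroup.mk (z * γ * z⁻¹) : GL (Fin 3) F ⧸ (Subgroup.zpowers (Units.mk0 ϖ hϖ0)).map (Matrix.GeneralLinearGroup.scalar (Fin 3))) u))
    (continuous_slice _ ρ hρ γ u u') (fun z hz => slice_support_subset_mixed hϖ hϖ0 Ω hmem _ hθ hγ hπ hT hN hc hD hdisc z hz)
    (fun ν₀ hν₀ x' => by haveI := hν₀; exact slice_hcusp21_mixed hϖ0 ρ hρ hsc hBinv u u' hγ hπ ν₀ x')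
    (fun ν₀ hν₀ x' => by haveI := hν₀; exact slice_hcusp21bar_mixed hϖ0 ρ hρ hsc hBinv u u' hγ hπ ν₀ x') hx₀

/-! ## §2  At an integral representative in normal form -/

include hϖ hρ hsc hBinv hmem hK in
/-- **`hcanc` AT AN INTEGRAL SPLIT REPRESENTATIVE**: `g₁ = y·diag(d)·y⁻¹` (`d` injective) INTEGRAL with `ϖ^h g₁⁻¹` integral and `|disc χ_{g₁}| = q^{−L₀}`; then for every `n` and every
`R ≥ 150·(s₀ + h + L₀ + 1)`: `∫_{Ω n} θ(x̄·mk g₁·x̄⁻¹) dμ' = ∫_{Ω n ∩ Ω R} …` (`𝔅_h(g₁)` ⇒ ★ T18-split `𝔅_{6h+L₀}(y·ϖ^e)`, `ϖ^e` commutes with `γ = diag d`; depth `L₀` serves as the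
`D♮`-depth since `det g₁` is integral; §1 with `R_split = 150s₀ + 78h + 38L₀ + 6`). [cite: HarishChandra1970, Part VII §2 Thm 18 Cor p. 69, Thm 20 p. 70, §3 pp. 71–72] -/
theorem setIntegral_conj_eq_setIntegral_inter_of_integral_split {s₀ : ℕ}
    (hθ : ∀ g : GL (Fin 3) F ⧸ (Subgroup.zpowers (Units.mk0 ϖ hϖ0)).map (Matrix.GeneralLinearGroup.scalar (Fin 3)), B u' (ρ g u) ≠ 0 → g ∈ Ω s₀)
    {g₁ y : GL (Fin 3) F} {d : Fin 3 → F} (hd : Function.Injective d)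
    (hg : (g₁ : Matrix (Fin 3) (Fin 3) F) = (y : Matrix (Fin 3) (Fin 3) F) * Matrix.diagonal d * ((y⁻¹ : GL (Fin 3) F) : Matrix (Fin 3) (Fin 3) F))
    {h : ℕ} (hint : ∀ i j, Valued.v ((g₁ : Matrix (Fin 3) (Fin 3) F) i j) ≤ 1)
    (hinv : ∀ i j, Valued.v (ϖ ^ h * ((g₁⁻¹ : GL (Fin 3) F) : Matrix (Fin 3) (Fin 3) F) i j) ≤ 1)
    {L₀ : ℕ} (hL₀ : Valued.v ((g₁ : Matrix (Fin 3) (Fin 3) F)).charpoly.discr = WithZero.exp (-(L₀ : ℤ)))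
    {R : ℕ} (hR : 150 * (s₀ + h + L₀ + 1) ≤ R) (n : ℕ) :
    ∫ x in Ω n, B u' (ρ (x * QuotientGroup.mk g₁ * x⁻¹) u) ∂μ' = ∫ x in Ω n ∩ Ω R, B u' (ρ (x * QuotientGroup.mk g₁ * x⁻¹) u) ∂μ' := by
  obtain ⟨γ, hγ, hg₁⟩ := exists_conj_eq_of_coe hg
  -- `𝔅_h(y γ y⁻¹)`
  have hball : ∀ i j k l, Valued.v (ϖ ^ h * (((y * γ * y⁻¹ : GL (Fin 3) F) : Matrix (Fin 3) (Fin 3) F) i j *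
      (((y * γ * y⁻¹)⁻¹ : GL (Fin 3) F) : Matrix (Fin 3) (Fin 3) F) k l)) ≤ 1 := by
    rw [← hg₁]; exact adBall_of_integral_of_inv hint hinv
  -- `det g₁ = d₀d₁d₂` is integral, `disc χ_{g₁} = Δ(d)²`
  have hdet : ((g₁ : Matrix (Fin 3) (Fin 3) F)).det = d 0 * d 1 * d 2 := by
    rw [hg₁, Units.val_mul, Units.val_mul, Matrix.det_units_conj, hγ, Matrix.det_diagonal, Fin.prod_univ_three]
  have hdetv : Valued.v (d 0 * d 1 * d 2) ≤ 1 := by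
    rw [← hdet]
    have h1 := K2E3GL3FinConjBoxes.v_det_le_of_entries_le (M := 0) ((g₁ : Matrix (Fin 3) (Fin 3) F)) (fun i j => by rw [WithZero.exp_zero]; exact hint i j)
    rwa [mul_zero, WithZero.exp_zero] at h1
  have hdisc : ((g₁ : Matrix (Fin 3) (Fin 3) F)).charpoly.discr = ((d 0 - d 1) * (d 0 - d 2) * (d 1 - d 2)) ^ 2 := by
    rw [hg, Matrix.coe_units_inv, Matrix.charpoly_units_conj, K2E3SplitTorusDepthFromDiscriminant.charpoly_discr_diagonal_fin_three]; ring
  have hϖL : Valued.v (ϖ ^ L₀) = WithZero.exp (-(L₀ : ℤ)) := by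
    rw [map_pow, hϖ, ← WithZero.exp_nsmul]; congr 1; simp
  have hD : Valued.v (ϖ ^ L₀ * (d 0 * d 1 * d 2) ^ 2) ≤ Valued.v (((d 0 - d 1) * (d 0 - d 2) * (d 1 - d 2)) ^ 2) := by
    rw [map_mul, map_pow Valued.v (d 0 * d 1 * d 2), ← hdisc, hL₀, ← hϖL]
    exact mul_le_of_le_one_right' (pow_le_one' hdetv _)
  -- ★ T18-split: `y ↦ y₁ = y·ϖ^e`
  obtain ⟨e, he⟩ := exists_adBall_mul_zpowDiagGL_of_adBall_conj hϖ hϖ0 hγ hball hD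
  have hcomm : zpowDiagGL (n := 3) hϖ0 e * γ = γ * zpowDiagGL (n := 3) hϖ0 e :=
    mul_comm_of_mem_standardLeviGL_id (zpowDiagGL_mem_standardLeviGL (id : Fin 3 → Fin 3) hϖ0 e) (mem_standardLeviGL_of_coe_eq_diagonal id hγ)
  have hg₁' : y * zpowDiagGL (n := 3) hϖ0 e * γ * (y * zpowDiagGL (n := 3) hϖ0 e)⁻¹ = g₁ := by
    rw [hg₁]
    calc y * zpowDiagGL (n := 3) hϖ0 e * γ * (y * zpowDiagGL (n := 3) hϖ0 e)⁻¹
        = y * (zpowDiagGL (n := 3) hϖ0 e * γ) * (zpowDiagGL (n := 3) hϖ0 e)⁻¹ * y⁻¹ := by group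
      _ = y * (γ * zpowDiagGL (n := 3) hϖ0 e) * (zpowDiagGL (n := 3) hϖ0 e)⁻¹ * y⁻¹ := by rw [hcomm]
      _ = y * γ * y⁻¹ := by group
  have key := setIntegral_conj_eq_setIntegral_inter_split_of_le hϖ hϖ0 ρ hρ hsc hBinv u u' Ω hmem hK μ' hθ hγ hd hD he (R := R) (by omega) n
  rwa [hg₁'] at key

include hϖ hρ hsc hBinv hmem hK in
/-- **`hcanc` AT AN INTEGRAL MIXED REPRESENTATIVE**: `g₁ = y·[[e₀,e₁,0],[e₂,e₃,0],[0,0,e₄]]·y⁻¹` INTEGRAL, `χ_{[[e₀,e₁],[e₂,e₃]]}` irreducible, `|disc χ_{g₁}| = q^{−L₀}`; then for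
every `n` and every `R ≥ 45 s₀ + 13 L₀ + 1`: `∫_{Ω n} θ(x̄·mk g₁·x̄⁻¹) dμ' = ∫_{Ω n ∩ Ω R} …` (★ companion normal form; `T, N, c` integral by ★ `v_T_le_one` &c.; ★ T18-mixed
`y ↦ y·t`, `𝔅_{L₀}(y t)`; depths `L = L_d = L₀`; §1 — the height `h` of `g₁` does not enter). [cite: HarishChandra1970, Part VII §2 Thm 18 Cor p. 69, Thm 20 p. 70, §3 pp. 72–73] -/
theorem setIntegral_conj_eq_setIntegral_inter_of_integral_mixed {s₀ : ℕ}
    (hθ : ∀ g : GL (Fin 3) F ⧸ (Subgroup.zpowers (Units.mk0 ϖ hϖ0)).map (Matrix.GeneralLinearGroup.scalar (Fin 3)), B u' (ρ g u) ≠ 0 → g ∈ Ω s₀)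
    {g₁ y : GL (Fin 3) F} {e : Fin 5 → F} (hirr : Irreducible ((!![e 0, e 1; e 2, e 3] : Matrix (Fin 2) (Fin 2) F)).charpoly)
    (hg : (g₁ : Matrix (Fin 3) (Fin 3) F) =
      (y : Matrix (Fin 3) (Fin 3) F) * !![e 0, e 1, 0; e 2, e 3, 0; 0, 0, e 4] * ((y⁻¹ : GL (Fin 3) F) : Matrix (Fin 3) (Fin 3) F))
    (hint : ∀ i j, Valued.v ((g₁ : Matrix (Fin 3) (Fin 3) F) i j) ≤ 1)
    {L₀ : ℕ} (hL₀ : Valued.v ((g₁ : Matrix (Fin 3) (Fin 3) F)).charpoly.discr = WithZero.exp (-(L₀ : ℤ)))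
    {R : ℕ} (hR : 45 * s₀ + 13 * L₀ + 1 ≤ R) (n : ℕ) :
    ∫ x in Ω n, B u' (ρ (x * QuotientGroup.mk g₁ * x⁻¹) u) ∂μ' = ∫ x in Ω n ∩ Ω R, B u' (ρ (x * QuotientGroup.mk g₁ * x⁻¹) u) ∂μ' := by
  -- companion normal form `g₁ = y' γ y'⁻¹`
  obtain ⟨y₂, hy₂⟩ := exists_leviBlock_eq_conj_companion e hirr
  set T : F := e 0 + e 3 with hTdef
  set N₀ : F := e 0 * e 3 - e 1 * e 2 with hN₀def
  set c₀ : F := e 4 with hc₀def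
  have hg' : (g₁ : Matrix (Fin 3) (Fin 3) F) = ((y * y₂ : GL (Fin 3) F) : Matrix (Fin 3) (Fin 3) F) * !![0, -N₀, 0; 1, T, 0; 0, 0, c₀] *
      (((y * y₂)⁻¹ : GL (Fin 3) F) : Matrix (Fin 3) (Fin 3) F) := by
    rw [hg, hy₂, mul_inv_rev, Units.val_mul, Units.val_mul]
    simp only [Matrix.mul_assoc]
  obtain ⟨γ, hγ, hg₁⟩ := exists_conj_eq_of_coe hg'
  have hπ : ∀ x : F, x ^ 2 - T * x + N₀ ≠ 0 := by
    refine forall_sq_sub_add_ne_zero_of_irreducible ?_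
    rw [← charpoly_block_eq e]; exact hirr
  have hy : ∀ i j, Valued.v (((((y * y₂) * γ * (y * y₂)⁻¹ : GL (Fin 3) F)) : Matrix (Fin 3) (Fin 3) F) i j) ≤ 1 := by rw [← hg₁]; exact hint
  have hT1 : Valued.v T ≤ 1 := v_T_le_one hγ hy
  have hN1 : Valued.v N₀ ≤ 1 := v_N_le_one hγ hy
  have hc1 : Valued.v c₀ ≤ 1 := v_c_le_one hγ hy
  -- the discriminant and the depths `L = L_d = L₀`
  have hdisc : ((g₁ : Matrix (Fin 3) (Fin 3) F)).charpoly.discr = (T ^ 2 - 4 * N₀) * (c₀ ^ 2 - T * c₀ + N₀) ^ 2 := by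
    rw [hg, Matrix.coe_units_inv, Matrix.charpoly_units_conj, discr_charpoly_leviBlock]
  have hϖL : Valued.v (ϖ ^ L₀) = WithZero.exp (-(L₀ : ℤ)) := by
    rw [map_pow, hϖ, ← WithZero.exp_nsmul]; congr 1; simp
  have hD : Valued.v (ϖ ^ L₀) ≤ Valued.v ((T ^ 2 - 4 * N₀) * (c₀ ^ 2 - T * c₀ + N₀) ^ 2) := by rw [hϖL, ← hL₀, hdisc]
  have hπc1 : Valued.v (c₀ ^ 2 - T * c₀ + N₀) ≤ 1 := by
    refine Valuation.map_add_le _ (Valuation.map_sub_le _ ?_ ?_) hN1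
    · rw [map_pow]; exact pow_le_one' hc1 _
    · rw [map_mul]; exact mul_le_one' hT1 hc1
  have hdisc' : Valued.v (ϖ ^ L₀) ≤ Valued.v (T ^ 2 - 4 * N₀) :=
    hD.trans (by rw [map_mul, map_pow]; exact mul_le_of_le_one_right' (pow_le_one' hπc1 _))
  -- ★ T18-mixed: `y' ↦ y₁ = y'·t`
  obtain ⟨t, ht, hyt⟩ := exists_adBall_mul_centralizer_of_conj_integral_mixed hϖ0 hγ hπ hy hD
  have hg₁' : (y * y₂) * t * γ * ((y * y₂) * t)⁻¹ = g₁ := by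
    rw [hg₁]
    calc (y * y₂) * t * γ * ((y * y₂) * t)⁻¹ = (y * y₂) * (t * γ) * t⁻¹ * (y * y₂)⁻¹ := by group
      _ = (y * y₂) * (γ * t) * t⁻¹ * (y * y₂)⁻¹ := by rw [ht]
      _ = (y * y₂) * γ * (y * y₂)⁻¹ := by group
  have key := setIntegral_conj_eq_setIntegral_inter_mixed_of_le hϖ hϖ0 ρ hρ hsc hBinv u u' Ω hmem hK μ' hθ hγ hπ hT1 hN1 hc1 hD hdisc' hyt (R := R) (by omega) n
  rwa [hg₁'] at key

/-! ## §3  Both normal forms in one shape (the disjunction of ★ `ae_isCompact_centralizer_or_normalForm`) -/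

include hϖ hρ hsc hBinv hmem hK in
/-- **`hcanc` AT AN INTEGRAL REPRESENTATIVE, SPLIT OR MIXED.**  `θ = B u' (ρ · u)` supported in `Ω s₀`; `g₁` INTEGRAL with `ϖ^h g₁⁻¹` integral, in split normal form
(`y·diag d·y⁻¹`, `d` injective) OR mixed normal form (`y·[[e₀,e₁,0],[e₂,e₃,0],[0,0,e₄]]·y⁻¹`, `χ_{[[e₀,e₁],[e₂,e₃]]}` irreducible), `|disc χ_{g₁}| = q^{−L₀}`; then for
every `n` and every `R ≥ 150·(s₀ + h + L₀ + 1)`: **`∫_{Ω n} θ(x̄ · mk g₁ · x̄⁻¹) dμ' = ∫_{Ω n ∩ Ω R} θ(x̄ · mk g₁ · x̄⁻¹) dμ'`** — Harish-Chandra's `Ω(γ)`, radius linear in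
the support height, the height and the discriminant depth. [cite: HarishChandra1970, Part VII §2 Thm 20 p. 70, §3 pp. 71–73] [cite: Casselman1995, Thm. 5.3.1] -/
theorem setIntegral_conj_eq_setIntegral_inter_of_integral_normalForm {s₀ : ℕ}
    (hθ : ∀ g : GL (Fin 3) F ⧸ (Subgroup.zpowers (Units.mk0 ϖ hϖ0)).map (Matrix.GeneralLinearGroup.scalar (Fin 3)), B u' (ρ g u) ≠ 0 → g ∈ Ω s₀)
    (g₁ : GL (Fin 3) F) (h L₀ : ℕ)
    (hnf : (∃ (y : GL (Fin 3) F) (d : Fin 3 → F), Function.Injective d ∧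
        (g₁ : Matrix (Fin 3) (Fin 3) F) = (y : Matrix (Fin 3) (Fin 3) F) * Matrix.diagonal d * ((y⁻¹ : GL (Fin 3) F) : Matrix (Fin 3) (Fin 3) F)) ∨
      (∃ (y : GL (Fin 3) F) (e : Fin 5 → F), Irreducible ((!![e 0, e 1; e 2, e 3] : Matrix (Fin 2) (Fin 2) F)).charpoly ∧
        (g₁ : Matrix (Fin 3) (Fin 3) F) = (y : Matrix (Fin 3) (Fin 3) F) * !![e 0, e 1, 0; e 2, e 3, 0; 0, 0, e 4] * ((y⁻¹ : GL (Fin 3) F) : Matrix (Fin 3) (Fin 3) F)))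
    (hint : ∀ i j, Valued.v ((g₁ : Matrix (Fin 3) (Fin 3) F) i j) ≤ 1)
    (hinv : ∀ i j, Valued.v (ϖ ^ h * ((g₁⁻¹ : GL (Fin 3) F) : Matrix (Fin 3) (Fin 3) F) i j) ≤ 1)
    (hL₀ : Valued.v ((g₁ : Matrix (Fin 3) (Fin 3) F)).charpoly.discr = WithZero.exp (-(L₀ : ℤ)))
    {R : ℕ} (hR : 150 * (s₀ + h + L₀ + 1) ≤ R) (n : ℕ) :
    ∫ x in Ω n, B u' (ρ (x * QuotientGroup.mk g₁ * x⁻¹) u) ∂μ' = ∫ x in Ω n ∩ Ω R, B u' (ρ (x * QuotientGroup.mk g₁ * x⁻¹) u) ∂μ' := by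
  rcases hnf with ⟨y, d, hd, hg⟩ | ⟨y, e, hirr, hg⟩
  · exact setIntegral_conj_eq_setIntegral_inter_of_integral_split hϖ hϖ0 ρ hρ hsc hBinv u u' Ω hmem hK μ' hθ hd hg hint hinv hL₀ hR n
  · exact setIntegral_conj_eq_setIntegral_inter_of_integral_mixed hϖ hϖ0 ρ hρ hsc hBinv u u' Ω hmem hK μ' hθ hirr hg hint hL₀ (by omega) n

include hϖ hρ hsc hBinv hmem hK in
/-- **THE RADIUS PACKAGE FOR ASM-2** (★ `nonEllEstimates_of_radius`'s `hcanc`, per point): there is a support height `s₀` of `θ = B u' (ρ · u)` such that for every INTEGRAL `g₁`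
in (split or mixed) normal form with `ϖ^h g₁⁻¹` integral and `|disc χ_{g₁}| = q^{−L₀}`, every `n` and every `R ≥ 150·(s₀ + h + L₀ + 1)`:
`∫_{Ω n} θ(x̄·mk g₁·x̄⁻¹) dμ' = ∫_{Ω n ∩ Ω R} …`. [cite: HarishChandra1970, Part VII §3 pp. 72–73 (`Ω(γ)`)] -/
theorem exists_radius_setIntegral_conj_eq_setIntegral_inter_of_integral_normalForm :
    ∃ s₀ : ℕ, ∀ (g₁ : GL (Fin 3) F) (h L₀ : ℕ),
      ((∃ (y : GL (Fin 3) F) (d : Fin 3 → F), Function.Injective d ∧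
          (g₁ : Matrix (Fin 3) (Fin 3) F) = (y : Matrix (Fin 3) (Fin 3) F) * Matrix.diagonal d * ((y⁻¹ : GL (Fin 3) F) : Matrix (Fin 3) (Fin 3) F)) ∨
        (∃ (y : GL (Fin 3) F) (e : Fin 5 → F), Irreducible ((!![e 0, e 1; e 2, e 3] : Matrix (Fin 2) (Fin 2) F)).charpoly ∧
          (g₁ : Matrix (Fin 3) (Fin 3) F) =
            (y : Matrix (Fin 3) (Fin 3) F) * !![e 0, e 1, 0; e 2, e 3, 0; 0, 0, e 4] * ((y⁻¹ : GL (Fin 3) F) : Matrix (Fin 3) (Fin 3) F))) →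
      (∀ i j, Valued.v ((g₁ : Matrix (Fin 3) (Fin 3) F) i j) ≤ 1) → (∀ i j, Valued.v (ϖ ^ h * ((g₁⁻¹ : GL (Fin 3) F) : Matrix (Fin 3) (Fin 3) F) i j) ≤ 1) →
      Valued.v ((g₁ : Matrix (Fin 3) (Fin 3) F)).charpoly.discr = WithZero.exp (-(L₀ : ℤ)) →
      ∀ (n R : ℕ), 150 * (s₀ + h + L₀ + 1) ≤ R →
        ∫ x in Ω n, B u' (ρ (x * QuotientGroup.mk g₁ * x⁻¹) u) ∂μ' = ∫ x in Ω n ∩ Ω R, B u' (ρ (x * QuotientGroup.mk g₁ * x⁻¹) u) ∂μ' := by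
  obtain ⟨s₀, hs₀⟩ := exists_support_height hϖ hϖ0 ρ hρ hsc hBinv u u' Ω
  exact ⟨s₀, fun g₁ h L₀ hnf hint hinv hL₀ n R hR =>
    setIntegral_conj_eq_setIntegral_inter_of_integral_normalForm hϖ hϖ0 ρ hρ hsc hBinv u u' Ω hmem hK μ' hs₀ g₁ h L₀ hnf hint hinv hL₀ hR n⟩

end Summit.HodgeConjecture.HodgeConjecture.Cruxes.H413.K2E3GL3SupercuspOrbitalSliceCancellationNormalForm

end
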